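import Summits.Ventures.PercRepro.MSRMStarTheorem
import Summits.Ventures.PercRepro.MSTightSingPair
import Summits.Ventures.PercRepro.ExcessOneMonotoneOrCompleted

/-!
# The V chain assembled at a tight-trace element of a residue instance, Case I

A *residue instance* `Residue F u` (MSTightSingRemovable.lean): `F` of Marica–Schönheim excess
one, twin-free, empty core, full support, `∅, univ ∉ F`, valid (no complementary pair), `u` and
`ū = univ ∖ u` non-members with every member A- or C*-signable, and neither `F ∪ {u}` nor
`F ∪ {ū}` tight. Conjecture V says `F \\ F = insert ∅ F` or `F \\ F = insert ∅ (compls F)`.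

**Theorem (V, complex Case I).** At an element `r ∈ u` with a tight trace, `{r} ∈ F` (the complex
case of (SING-t)) and `u.erase r ∈ F` (Case I of `erase_mem_or_compl_erase_mem`), the residue data
give the (RM*) setting at `u₀ = u.erase r` (`RMStar.of_residue`): `u₀ ∈ F₀ ∖ F₁`, `ū ∉ F₁` by
validity, the signs (H3) read off `Cells`, the A-only member (H4) from `¬ Tight (insert u F)`
(`tight_insert_of_forall_sdiff_mem_diffsY`: if every `s ∈ F₀` had `u₀ ∖ s ∈ Y`, `F ∪ {u}` would
be tight), and the monotone labelling from Theorem (MA) (`monotone_or_completed`: the alternative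
«`r` addable» contradicts `u₀ ∈ F₀ ∖ F₁`, the alternative «a unique completing partnerless
member» is `u₀` itself, against (H4)). Hence `F \\ F = insert ∅ F`
(`residue_diffs_eq_of_caseI`); its mirror `residue_diffs_eq_compls_of_caseII` (co-complex, Case II)
is the same statement for `compls F`.

**What remains of Conjecture V on residue instances** is the mixed class — complex trace with
Case II, or its mirror — which the census says is empty (Addendum 23 §3: «`u₀ ∈ F₀` in every
residue pair»); it is isolated as the candidate Prop `CaseIOfComplex α` (never asserted), and
`conjV_residue_of_caseIOfComplex` derives V for every residue instance from it, by Theorem (TT)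
and (SING-t).
-/

namespace PercRepro.MSTight

open Finset
open scoped FinsetFamily

variable {α : Type*} [DecidableEq α] [Fintype α]

section Completion

variable {r : α} {F : Finset (Finset α)}

/-- **The C*-completion is tight.** At a complex trace, if `u₀ ∈ F₀` and every member `s`
avoiding `r` has `u₀ ∖ s ∈ Y`, then `F ∪ {insert r u₀}` is tight: every new difference is an old
one. -/
theorem tight_insert_of_forall_sdiff_mem_diffsY (hF : (F \\ F).card = F.card + 1)
    (hP : Tight (proj r F)) (hr : ({r} : Finset α) ∈ F)
    (hsing : ∀ a, a ≠ r → ({a} : Finset α) ∈ proj r F) {u₀ : Finset α} (hu0 : u₀ ∈ part0 r F)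
    (hu1 : u₀ ∉ partr r F) (hall : ∀ s ∈ part0 r F, u₀ \ s ∈ diffsY r F) :
    Tight (insert (insert r u₀) F) := by
  have hru : r ∉ u₀ := (mem_part0.1 hu0).2
  have hu0F : u₀ ∈ F := (mem_part0.1 hu0).1
  have hnew : insert r u₀ ∉ F := fun h => hu1 (mem_partr.2 ⟨hru, h⟩)
  have hX : diffsX r F = proj r F := diffsX_eq_proj_of_singleton_mem hP hr
  -- a face of the trace is a difference avoiding `r`
  have hface : ∀ e ∈ proj r F, e ∈ F \\ F := by
    intro e he
    rw [← hX, ← diffs_filter_notMem] at he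
    exact (mem_filter.1 he).1
  have hsub : insert (insert r u₀) F \\ insert (insert r u₀) F ⊆ F \\ F := by
    intro E hE
    obtain ⟨A, hA, B, hB, rfl⟩ := Finset.mem_diffs.1 hE
    rcases mem_insert.1 hA with rfl | hA <;> rcases mem_insert.1 hB with rfl | hB
    · rw [Finset.sdiff_self]
      exact Finset.mem_diffs.2 ⟨{r}, hr, {r}, hr, Finset.sdiff_self _⟩
    · by_cases hrB : r ∈ B
      · -- `(insert r u₀) \ B = u₀ \ B.erase r`, a face of `u₀`
        have h1 : insert r u₀ \ B = u₀ \ B.erase r := by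
          ext a
          simp only [mem_sdiff, mem_insert, mem_erase, not_and]
          constructor
          · rintro ⟨(rfl | ha), haB⟩
            · exact absurd hrB haB
            · exact ⟨ha, fun _ => fun h => haB h⟩
          · rintro ⟨ha, haB⟩
            exact ⟨Or.inr ha, fun h => haB (fun hr' => hru (hr' ▸ ha)) h⟩
        rw [h1]
        exact hface _ (mem_proj_of_subset hP hr hsing (RMStar.mem_proj_of_mem_part0 hu0)
          sdiff_subset)
      · -- `(insert r u₀) \ B = insert r (u₀ \ B)` with `u₀ \ B ∈ Y`
        have h1 : insert r u₀ \ B = insert r (u₀ \ B) := by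
          rw [insert_sdiff_of_notMem _ hrB]
        rw [h1]
        have h2 : u₀ \ B ∈ diffsY r F := hall B (mem_part0.2 ⟨hB, hrB⟩)
        have : insert r (u₀ \ B) ∈ (F \\ F).filter (fun E => r ∈ E) := by
          rw [diffs_filter_mem]
          exact mem_image_of_mem _ h2
        exact (mem_filter.1 this).1
    · -- `A \ insert r u₀ ⊆ A.erase r`, a face of the trace
      have h1 : A \ insert r u₀ ⊆ A.erase r := by
        intro a ha
        rw [mem_sdiff, mem_insert, not_or] at ha
        exact mem_erase.2 ⟨ha.2.1, ha.1⟩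
      have h2 : A.erase r ∈ proj r F := mem_proj.2 ⟨A, hA, rfl⟩
      exact hface _ (mem_proj_of_subset hP hr hsing h2 h1)
    · exact Finset.sdiff_mem_diffs hA hB
  have hcard : (insert (insert r u₀) F).card = F.card + 1 := card_insert_of_notMem hnew
  have h1 := card_le_card hsub
  have h2 := Finset.card_le_card_diffs (insert (insert r u₀) F)
  unfold Tight
  omega

end Completion

section CaseI

variable {F : Finset (Finset α)} {u : Finset α} {r : α}

/-- `ubar r (u.erase r) = univ ∖ u` for `r ∈ u`. -/
theorem ubar_erase_eq (hru : r ∈ u) : ubar r (u.erase r) = univ \ u := by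
  rw [ubar, insert_erase hru]

/-- `insert r (univ ∖ u) = univ ∖ u.erase r` for `r ∈ u`. -/
theorem insert_compl_eq (hru : r ∈ u) : insert r (univ \ u) = univ \ u.erase r := by
  ext a
  simp only [mem_insert, mem_sdiff, mem_univ, true_and, mem_erase, not_and]
  constructor
  · rintro (rfl | ha)
    · exact fun h => absurd rfl h
    · exact fun _ => ha
  · intro h
    by_cases har : a = r
    · exact Or.inl har
    · exact Or.inr (h har)

/-- **The residue data give the (RM*) setting** at `u₀ = u.erase r`, in the complex Case I. -/
theorem RMStar.of_residue (h : Residue F u) (hP : Tight (proj r F)) (hr : ({r} : Finset α) ∈ F)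
    (hru : r ∈ u) (hI : u.erase r ∈ F) : RMStar r F (u.erase r) := by
  have hsing : ∀ a, a ≠ r → ({a} : Finset α) ∈ proj r F := fun a ha =>
    singleton_mem_proj_of_twinFree h.hexc hP hr (fun a b hab => (h.htf a b hab).symm) h.hsupp ha
  have hu0 : u.erase r ∈ part0 r F := mem_part0.2 ⟨hI, notMem_erase r u⟩
  have hu1 : u.erase r ∉ partr r F := fun h1 => by
    have := (mem_partr.1 h1).2
    rw [insert_erase hru] at this
    exact h.hu this
  have hubar : ubar r (u.erase r) ∉ partr r F := by
    rw [ubar_erase_eq hru]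
    intro h1
    have := (mem_partr.1 h1).2
    rw [insert_compl_eq hru] at this
    exact h.hvalid _ hI this
  -- the signs: A-signable gives `ū ∖ s ∈ P`, C*-signable gives `u₀ ∖ s ∈ Y`
  have hX : diffsX r F = proj r F := diffsX_eq_proj_of_singleton_mem hP hr
  have hsig : ∀ s ∈ part0 r F,
      ubar r (u.erase r) \ s ∈ proj r F ∨ u.erase r \ s ∈ diffsY r F := by
    intro s hs
    have hrs : r ∉ s := (mem_part0.1 hs).2
    rcases h.hsig s (mem_part0.1 hs).1 with ⟨_, hA⟩ | ⟨_, hC⟩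
    · left
      rw [ubar_erase_eq hru]
      have h1 : (univ \ s) ∩ (univ \ u) = (univ \ u) \ s := by
        ext a; simp only [mem_inter, mem_sdiff, mem_univ, true_and]; tauto
      rw [h1] at hA
      have h2 : (univ \ u) \ s ∈ (F \\ F).filter (fun E => r ∉ E) :=
        mem_filter.2 ⟨hA, fun hr' => (mem_sdiff.1 (mem_sdiff.1 hr').1).2 hru⟩
      rw [diffs_filter_notMem, hX] at h2
      exact h2
    · right
      rw [Finset.sdiff_sdiff_eq_self (subset_univ u)] at hC
      have h1 : (univ \ s) ∩ u = insert r (u.erase r \ s) := by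
        ext a
        simp only [mem_inter, mem_sdiff, mem_univ, true_and, mem_insert, mem_erase]
        constructor
        · rintro ⟨has, hau⟩
          by_cases har : a = r
          · exact Or.inl har
          · exact Or.inr ⟨⟨har, hau⟩, has⟩
        · rintro (rfl | ⟨⟨_, hau⟩, has⟩)
          · exact ⟨hrs, hru⟩
          · exact ⟨has, hau⟩
      rw [h1] at hC
      have h2 : insert r (u.erase r \ s) ∈ (F \\ F).filter (fun E => r ∈ E) :=
        mem_filter.2 ⟨hC, mem_insert_self r _⟩
      rw [diffs_filter_mem] at h2
      obtain ⟨y, hy, hy'⟩ := mem_image.1 h2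
      have hry : r ∉ y := notMem_of_mem_diffsY hy
      have hry' : r ∉ u.erase r \ s := fun h' => (mem_erase.1 (mem_sdiff.1 h').1).1 rfl
      have : y = u.erase r \ s := by
        rw [← erase_insert hry, hy', erase_insert hry']
      rw [← this]
      exact hy
  -- the A-only member: otherwise `F ∪ {u}` would be tight
  have haonly : ∃ s ∈ part0 r F,
      ubar r (u.erase r) \ s ∈ proj r F ∧ u.erase r \ s ∉ diffsY r F := by
    by_contra hcon
    apply h.hnt
    rw [← insert_erase hru]
    refine tight_insert_of_forall_sdiff_mem_diffsY h.hexc hP hr hsing hu0 hu1 ?_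
    intro s hs
    by_contra hs4
    rcases hsig s hs with hA | hC
    · exact hcon ⟨s, hs, hA, hs4⟩
    · exact hs4 hC
  -- the monotone labelling, from Theorem (MA)
  have hmono : (∀ t ∈ partr r F, ∀ e ∈ proj r F, e ⊆ t → e ∈ partr r F) ∧
      (∀ s ∈ part0 r F, ∀ e ∈ proj r F, s ⊆ e → e ∈ part0 r F) := by
    rcases monotone_or_completed h.hexc hP hr h.hempty hsing with hm | hadd | ⟨x, hx0, hx1, _, hxu, hxc⟩
    · exact hm
    · exact absurd (hadd _ hu0) hu1
    · exfalso
      obtain ⟨s, hs, _, hs4⟩ := haonly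
      have := hxu _ hu0 hu1
      subst this
      exact hs4 (hxc s hs)
  exact ⟨h.hexc, hP, hr, h.hempty, hsing, hmono.1, hmono.2, hu0, hu1, hubar, hsig, haonly⟩

/-- **Conjecture V at a complex Case-I element**: a residue instance with a tight trace at
`r ∈ u`, `{r} ∈ F` and `u.erase r ∈ F` is a block family, `F \\ F = insert ∅ F`. -/
theorem residue_diffs_eq_of_caseI (h : Residue F u) (hP : Tight (proj r F))
    (hr : ({r} : Finset α) ∈ F) (hru : r ∈ u) (hI : u.erase r ∈ F) : F \\ F = insert ∅ F := by
  have hR := RMStar.of_residue h hP hr hru hI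
  exact diffs_eq_insert_empty_of_rmstar hR.exc hR.tightP hR.singleton_mem hR.empty_notMem hR.sing
    hR.down hR.up hR.u0_mem hR.u0_notMem hR.ubar_notMem hR.signable hR.aonly h.huniv h.hsupp

/-- **The mirror**: at a co-complex Case-II element (`univ.erase r ∈ F`, `univ ∖ u.erase r ∈ F`)
the residue instance is the mirror of a block family, `F \\ F = insert ∅ (compls F)`. -/
theorem residue_diffs_eq_compls_of_caseII (h : Residue F u) (hP : Tight (proj r F))
    (hr : univ.erase r ∈ F) (hru : r ∈ u) (hII : univ \ u.erase r ∈ F) :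
    F \\ F = insert ∅ (compls F) := by
  have h1 := residue_diffs_eq_of_caseI h.compls ((tight_proj_compls_iff F r).2 hP)
    (by rw [mem_compls, compl_singleton_eq]; exact hr) hru (by rw [mem_compls]; exact hII)
  rwa [diffs_compls] at h1

end CaseI

section Candidate

variable (α)

/-- **The mixed class, as a candidate Prop** (never asserted): at an element `r ∈ u` of a residue
instance with a tight trace and `{r} ∈ F`, Case I holds: `u.erase r ∈ F`. Census: Addendum 23 §3
(«`u₀ ∈ F₀` in every residue pair, `ū ∈ F₁` never»: 1,218 + 1,197,320 residue pairs on 4 and 5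
points, 0 exceptions). -/
def CaseIOfComplex : Prop :=
  ∀ (F : Finset (Finset α)) (u : Finset α) (r : α), Residue F u → Tight (proj r F) → r ∈ u →
    ({r} : Finset α) ∈ F → u.erase r ∈ F

variable {α}

variable {F : Finset (Finset α)} {u : Finset α}

/-- **Conjecture V on residue instances, modulo `CaseIOfComplex α`**, at an element `r ∈ u` with a
tight trace: (SING-t) gives the complex or the co-complex case, `CaseIOfComplex` (for `F` or for
`compls F`) gives Case I resp. Case II, and the two theorems above conclude. -/
theorem conjV_residue_of_caseIOfComplex_of_mem (hC : CaseIOfComplex α) (h : Residue F u) {r : α}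
    (hP : Tight (proj r F)) (hru : r ∈ u) :
    F \\ F = insert ∅ F ∨ F \\ F = insert ∅ (compls F) := by
  rcases sing_t_of_residue h hP with hr | hr
  · exact Or.inl (residue_diffs_eq_of_caseI h hP hr hru (hC F u r h hP hru hr))
  · right
    have hI := hC (compls F) u r h.compls ((tight_proj_compls_iff F r).2 hP) hru
      (by rw [mem_compls, compl_singleton_eq]; exact hr)
    rw [mem_compls] at hI
    exact residue_diffs_eq_compls_of_caseII h hP hr hru hI

/-- **Conjecture V on residue instances, modulo `CaseIOfComplex α`**: Theorem (TT) supplies a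
tight-trace element, the symmetry `u ↔ ū` puts it inside the near-member. -/
theorem conjV_residue_of_caseIOfComplex (hC : CaseIOfComplex α) (h : Residue F u) :
    F \\ F = insert ∅ F ∨ F \\ F = insert ∅ (compls F) := by
  obtain ⟨r, _, _, hP, _⟩ := exists_two_tight_proj h.htf h.hexc
  by_cases hru : r ∈ u
  · exact conjV_residue_of_caseIOfComplex_of_mem hC h hP hru
  · exact conjV_residue_of_caseIOfComplex_of_mem hC h.swap hP (mem_sdiff.2 ⟨mem_univ r, hru⟩)

end Candidate

end PercRepro.MSTight
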